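import Mathlib
import Summits.CriticalPhenomena.CardyFormulaZ2.Theorems.CardyFlipRussoSquareFromVoronoiHubFatTubePart1
import Summits.CriticalPhenomena.CardyFormulaZ2.Theorems.CardyFlipRussoSquareFromVoronoiHubFatTubePart2

/-!
# Fat tubes in defect-free Voronoi tessellations, Part 3: the door of two adjacent cells

Crux `Summit.CriticalPhenomena.CardyFormulaZ2.Theses.CardyFlipRusso.SquareFromVoronoiHub`
(stmt-CriticalPhenomena-6434), line `Sketch`, stub `stub_fatTube`.  **The door lemma**
(`exists_door`, registered sub-goal `stub_fatTube_part3`): under the local clauses of the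
no-defect event — (i) no empty `ρ`-disc in the window `V`, (ii) nuclei of `V` are `≥ r₂` from
every other nucleus, (iii) no pseudo-edge of length `< ℓ₀` — two DISTINCT nuclei `b, b'` whose
cells share a point `z₀` with `closedBall z₀ (7ρ) ⊆ V` admit a DOOR: a point `m` of the bisector
with `|mb| = |mb'| < ρ` which is `μ`-deep for `b` and for `b'` with respect to every third
nucleus `q`: `2μ|qb| ≤ |mq|² - |mb|²` and `2μ|qb'| ≤ |mq|² - |mb'|²`, as soon as `4μ ≤ r₂` and
`64μρ ≤ ℓ₀r₂`.  Proof: in the bisector frame of Part 2 the parameters of the common edge form a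
closed interval `[sm, sp] ⊆ (-ρ, ρ)` (cells are small); its ends are blocked by distinct third
nuclei (Part 2), so (iii) gives `sp - sm ≥ ℓ₀`; the door is the midpoint, and its clearance is the
real inequality `door_core'` of Part 2 for the finitely many near nuclei, a triangle inequality
for the far ones.
-/

noncomputable section

namespace Summit.CriticalPhenomena.CardyFormulaZ2.Cruxes.SquareFromVoronoiHub.VoronoiBlocks.Faithful

open scoped Topology ComplexConjugate
open Set Metric
open Literature.Probability.LatticeModels (voronoiCell mem_voronoiCell_iff self_mem_voronoiCell)

/-- **The door lemma** (see the module docstring). [folklore] -/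
theorem exists_door {X V : Set ℂ} {ρ r₂ ℓ₀ μ : ℝ} (hρ : 0 < ρ) (hr₂ : 0 < r₂) (hℓ₀ : 0 < ℓ₀)
    (hμ : 0 < μ) (h4 : 4 * μ ≤ r₂) (h64 : 64 * μ * ρ ≤ ℓ₀ * r₂)
    (hcov : ∀ z ∈ V, ∃ p ∈ X, dist z p < ρ)
    (hsep : ∀ p ∈ X, ∀ q ∈ X, p ∈ V → dist p q < r₂ → p = q)
    (hedge : ∀ p ∈ X, ∀ q ∈ X, ∀ r ∈ X, ∀ r' ∈ X, ∀ v v' : ℂ, p ∈ V →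
      p ≠ q → p ≠ r → q ≠ r → p ≠ r' → q ≠ r' → r ≠ r' →
      dist p v = dist q v → dist q v = dist r v → dist p v ≤ 2 * ρ →
      dist p v' = dist q v' → dist q v' = dist r' v' → dist p v' ≤ 2 * ρ → ℓ₀ ≤ dist v v')
    {b b' z₀ : ℂ} (hb : b ∈ X) (hb' : b' ∈ X) (hbb' : b ≠ b')
    (hz₀ : z₀ ∈ voronoiCell X b) (hz₀' : z₀ ∈ voronoiCell X b')
    (hV : closedBall z₀ (7 * ρ) ⊆ V) :
    ∃ m : ℂ, dist m b < ρ ∧ dist m b = dist m b' ∧ ∀ q ∈ X, q ≠ b → q ≠ b' →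
      2 * μ * dist q b ≤ dist m q ^ 2 - dist m b ^ 2 ∧
        2 * μ * dist q b' ≤ dist m q ^ 2 - dist m b' ^ 2 := by
  -- the window
  have hz₀V : z₀ ∈ V := hV (mem_closedBall_self (by positivity))
  obtain ⟨p₀, hp₀, hz₀p₀⟩ := hcov z₀ hz₀V
  have hdb : dist b z₀ < ρ := by rw [dist_comm]; exact (hz₀ p₀ hp₀).trans_lt hz₀p₀
  have hdb' : dist b' z₀ < ρ := by rw [dist_comm]; exact (hz₀' p₀ hp₀).trans_lt hz₀p₀
  have hwin : ∀ z, dist z z₀ ≤ 7 * ρ → z ∈ V := fun z hz => hV (mem_closedBall.2 hz)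
  have hbV : b ∈ V := hwin b (by linarith)
  have hb'V : b' ∈ V := hwin b' (by linarith)
  have hbb'r : r₂ ≤ dist b b' := not_lt.1 fun h => hbb' (hsep b hb b' hb' hbV h)
  have hbb'ρ : dist b b' < 2 * ρ := by
    have := dist_triangle b z₀ b'; rw [dist_comm z₀ b'] at this; linarith
  have hμρ : 2 * μ < ρ := by linarith
  -- the frame
  obtain ⟨n, hn⟩ : ∃ n : ℝ, n = dist b b' := ⟨_, rfl⟩
  have hn0 : 0 < n := by rw [hn]; exact dist_pos.2 hbb'
  obtain ⟨a, ha⟩ : ∃ a : ℝ, a = n / 2 := ⟨_, rfl⟩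
  have ha0 : 0 < a := by rw [ha]; positivity
  have haρ : a < ρ := by rw [ha]; linarith
  have haabs : |a| < ρ := by rwa [abs_of_pos ha0]
  obtain ⟨e, he_def⟩ : ∃ e : ℂ, e = (b' - b) / (n : ℂ) := ⟨_, rfl⟩
  have he : ‖e‖ = 1 := by
    rw [he_def, norm_div, Complex.norm_real, Real.norm_of_nonneg hn0.le, ← dist_eq_norm, dist_comm,
      ← hn, div_self hn0.ne']
  obtain ⟨c, hc⟩ : ∃ c : ℂ, c = (b + b') / 2 := ⟨_, rfl⟩
  have hnC : (n : ℂ) ≠ 0 := Complex.ofReal_ne_zero.2 hn0.ne'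
  have hbe : b = c - a * e := by
    rw [hc, ha, he_def]; push_cast; field_simp; ring
  have hb'e : b' = c + a * e := by
    rw [hc, ha, he_def]; push_cast; field_simp; ring
  subst hbe hb'e
  set zL : ℝ → ℂ := fun s => c + ((s : ℂ) * Complex.I) * e with hzL
  have hzc : Continuous zL :=
    continuous_const.add ((Complex.continuous_ofReal.mul continuous_const).mul continuous_const)
  -- the parameter set of the edge
  obtain ⟨S, hS⟩ : ∃ S : Set ℝ,
      S = {s : ℝ | c + ((s : ℂ) * Complex.I) * e ∈ voronoiCell X (c - a * e)} := ⟨_, rfl⟩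
  have hcellS : ∀ s ∈ S, zL s ∈ voronoiCell X (c - a * e) := fun s hs => by
    rw [hS] at hs; exact hs
  have hcellb : voronoiCell X (c - a * e) ⊆ ball (c - a * e) ρ :=
    voronoiCell_subset_ball hρ fun z hz => hcov z (hwin z (by
      have := dist_triangle z (c - a * e) z₀; rw [mem_closedBall] at hz; linarith))
  have hdistS : ∀ s ∈ S, dist (zL s) (c - a * e) < ρ := fun s hs =>
    mem_ball.1 (hcellb (hcellS s hs))
  have hSd : ∀ s ∈ S, a ^ 2 + s ^ 2 < ρ ^ 2 := by
    intro s hs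
    have h1 := hdistS s hs
    have h2 := dist_bis_sub_sq c e he s a
    have h3 : dist (zL s) (c - a * e) ^ 2 < ρ ^ 2 := pow_lt_pow_left₀ h1 dist_nonneg two_ne_zero
    linarith
  have hSρ : ∀ s ∈ S, |s| < ρ := fun s hs => by
    have := hSd s hs
    exact abs_lt.2 (abs_lt_of_sq_lt_sq' (by nlinarith only [this, sq_nonneg a]) hρ.le)
  -- `z₀` is a bisector point, so `S` is non-empty
  obtain ⟨ζ₀, hζ₀⟩ : ∃ ζ : ℂ, ζ = (z₀ - c) * conj e := ⟨_, rfl⟩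
  have hz₀e : z₀ = c + ζ₀ * e := by rw [hζ₀]; exact eq_frame c e he z₀
  have hre : ζ₀.re = 0 := re_eq_zero_of_dist_eq he ha0.ne' ζ₀ (by
    rw [← hz₀e]; exact le_antisymm (hz₀ _ hb') (hz₀' _ hb))
  have hs₀S : ζ₀.im ∈ S := by
    rw [hS, mem_setOf_eq]
    have : c + ((ζ₀.im : ℂ) * Complex.I) * e = z₀ := by
      rw [hz₀e]
      conv_rhs => rw [← Complex.re_add_im ζ₀, hre]
      push_cast; ring
    rw [this]; exact hz₀
  have hne : S.Nonempty := ⟨_, hs₀S⟩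
  have hcl : IsClosed S := by rw [hS]; exact (isClosed_voronoiCell' X _).preimage hzc
  have hbddA : BddAbove S := ⟨ρ, fun s hs => (abs_lt.1 (hSρ s hs)).2.le⟩
  have hbddB : BddBelow S := ⟨-ρ, fun s hs => (abs_lt.1 (hSρ s hs)).1.le⟩
  -- finitely many nuclei near `b`
  have hfin : (X ∩ closedBall (c - a * e) (5 * ρ)).Finite :=
    finite_of_isBounded_of_sep hr₂ (isBounded_closedBall.subset inter_subset_right)
      fun p hp q hq hpq => hsep p hp.1 q hq.1 (hwin p (by
        have := dist_triangle p (c - a * e) z₀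
        have h2 := mem_closedBall.1 hp.2
        linarith)) hpq
  -- the two blockers
  obtain ⟨qU, hqUX, hqUd, hqUκ⟩ := exists_blocker_sSup he hρ haabs hfin S hS hSρ hne hcl
  obtain ⟨qL, hqLX, hqLd, hqLκ⟩ := exists_blocker_sInf he hρ haabs hfin S hS hSρ hne hcl
  set sp := sSup S with hsp_def
  set sm := sInf S with hsm_def
  have hspS : sp ∈ S := hcl.csSup_mem hne hbddA
  have hsmS : sm ∈ S := hcl.csInf_mem hne hbddB
  have hsmsp : sm ≤ sp := csInf_le hbddB hspS
  have hsp : sp < ρ := (abs_lt.1 (hSρ sp hspS)).2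
  have hsm : -ρ < sm := (abs_lt.1 (hSρ sm hsmS)).1
  have hκb : ((c - (a : ℂ) * e - c) * conj e).im = 0 := by
    rw [show c - (a : ℂ) * e = c + ((-a : ℝ) : ℂ) * e by push_cast; ring, coord_frame c e he]
    simp
  have hκb' : ((c + (a : ℂ) * e - c) * conj e).im = 0 := by
    rw [coord_frame c e he]; simp
  have hqUb : qU ≠ c - a * e := fun h => by rw [h, hκb] at hqUκ; exact lt_irrefl _ hqUκ
  have hqUb' : qU ≠ c + a * e := fun h => by rw [h, hκb'] at hqUκ; exact lt_irrefl _ hqUκ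
  have hqLb : qL ≠ c - a * e := fun h => by rw [h, hκb] at hqLκ; exact lt_irrefl _ hqLκ
  have hqLb' : qL ≠ c + a * e := fun h => by rw [h, hκb'] at hqLκ; exact lt_irrefl _ hqLκ
  have hqUL : qU ≠ qL := fun h => by rw [h] at hqUκ; exact lt_asymm hqUκ hqLκ
  -- (iii): the edge is long
  have hℓ : ℓ₀ ≤ sp - sm := by
    have key := hedge (c - a * e) hb (c + a * e) hb' qU hqUX qL hqLX (zL sp) (zL sm) hbV hbb'
      hqUb.symm hqUb'.symm hqLb.symm hqLb'.symm hqUL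
      (by rw [dist_comm, dist_bis_sub_eq_dist_bis_add c e he, dist_comm])
      (by rw [dist_comm, ← dist_bis_sub_eq_dist_bis_add c e he, ← hqUd, dist_comm])
      (by rw [dist_comm]; linarith [hdistS sp hspS])
      (by rw [dist_comm, dist_bis_sub_eq_dist_bis_add c e he, dist_comm])
      (by rw [dist_comm, ← dist_bis_sub_eq_dist_bis_add c e he, ← hqLd, dist_comm])
      (by rw [dist_comm]; linarith [hdistS sm hsmS])
    rwa [dist_bis_bis c e he, abs_of_nonneg (sub_nonneg.2 hsmsp)] at key
  -- the door: the midpoint of the edge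
  set s₁ : ℝ := (sm + sp) / 2 with hs₁
  have hs₁d : a ^ 2 + s₁ ^ 2 < ρ ^ 2 := by
    have h1 := hSd sp hspS
    have h2 := hSd sm hsmS
    have h3 : s₁ ^ 2 ≤ (sm ^ 2 + sp ^ 2) / 2 := by
      rw [hs₁]; nlinarith only [sq_nonneg (sm - sp)]
    linarith
  have hmρ : dist (zL s₁) (c - a * e) < ρ := by
    have h := dist_bis_sub_sq c e he s₁ a
    exact (abs_lt_of_sq_lt_sq' (by rw [h]; exact hs₁d) hρ.le).2
  refine ⟨zL s₁, hmρ, dist_bis_sub_eq_dist_bis_add c e he s₁ a, fun q hq hqb hqb' => ?_⟩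
  have hqr : r₂ ≤ dist q (c - a * e) := by
    rw [dist_comm]; exact not_lt.1 fun h => hqb (hsep _ hb q hq hbV h).symm
  have hqr' : r₂ ≤ dist q (c + a * e) := by
    rw [dist_comm]; exact not_lt.1 fun h => hqb' (hsep _ hb' q hq hb'V h).symm
  have hmm : dist (zL s₁) (c + a * e) = dist (zL s₁) (c - a * e) :=
    (dist_bis_sub_eq_dist_bis_add c e he s₁ a).symm
  rw [hmm]
  have hqbb' : dist q (c + a * e) ≤ dist q (c - a * e) + 2 * ρ := by
    have := dist_triangle q (c - a * e) (c + a * e); linarith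
  by_cases hnear : dist q (c - a * e) ≤ 5 * ρ
  swap
  · -- a far nucleus
    have hD : 5 * ρ < dist q (c - a * e) := lt_of_not_ge hnear
    have htri : dist q (c - a * e) ≤ dist (zL s₁) q + dist (zL s₁) (c - a * e) := by
      have := dist_triangle q (zL s₁) (c - a * e); rwa [dist_comm q (zL s₁)] at this
    have h1 : dist q (c - a * e) - dist (zL s₁) (c - a * e) ≤ dist (zL s₁) q := by linarith
    have h2 : (dist q (c - a * e) - dist (zL s₁) (c - a * e)) ^ 2 ≤ dist (zL s₁) q ^ 2 :=
      pow_le_pow_left₀ (by linarith) h1 2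
    have h3 : dist q (c - a * e) * (dist q (c - a * e) - 2 * ρ) ≤
        dist (zL s₁) q ^ 2 - dist (zL s₁) (c - a * e) ^ 2 := by
      have h4 := mul_le_mul_of_nonneg_left hmρ.le (dist_nonneg : 0 ≤ dist q (c - a * e))
      nlinarith only [h2, h4]
    have h5 : 3 * ρ * dist q (c - a * e) ≤ dist q (c - a * e) * (dist q (c - a * e) - 2 * ρ) := by
      have := mul_le_mul_of_nonneg_left (by linarith : 5 * ρ ≤ dist q (c - a * e))
        (dist_nonneg : 0 ≤ dist q (c - a * e))
      nlinarith only [this]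
    have h6 := mul_le_mul_of_nonneg_right hμρ.le (dist_nonneg : 0 ≤ dist q (c - a * e))
    have h8 : 0 ≤ ρ * dist q (c - a * e) := mul_nonneg hρ.le dist_nonneg
    constructor
    · linarith only [h3, h5, h6, h8]
    · have h7 : 2 * μ * dist q (c + a * e) ≤ 2 * μ * (dist q (c - a * e) + 2 * ρ) :=
        mul_le_mul_of_nonneg_left hqbb' (by linarith)
      have h9 : 5 * ρ * (2 * ρ) ≤ dist q (c - a * e) * (dist q (c - a * e) - 3 * ρ) :=
        mul_le_mul hD.le (by linarith) (by positivity) dist_nonneg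
      have h10 : 2 * μ * ρ ≤ ρ * ρ := mul_le_mul_of_nonneg_right hμρ.le hρ.le
      have h11 : 0 ≤ ρ * ρ := mul_nonneg hρ.le hρ.le
      linarith only [h3, h6, h7, h8, h9, h10, h11]
  · -- a near nucleus: coordinates and the core inequality
    obtain ⟨ζ, hζ⟩ : ∃ ζ : ℂ, ζ = (q - c) * conj e := ⟨_, rfl⟩
    have hq' : q = c + ((ζ.re : ℂ) + ζ.im * Complex.I) * e := by
      rw [Complex.re_add_im, hζ]; exact eq_frame c e he q
    have hF : ∀ s : ℝ, dist (zL s) q ^ 2 - dist (zL s) (c - a * e) ^ 2 =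
        ζ.re ^ 2 + ζ.im ^ 2 - a ^ 2 - 2 * ζ.im * s := by
      intro s; rw [hq', dist_bis_sq c e he, dist_bis_sub_sq c e he]; ring
    have hDb : dist q (c - a * e) ^ 2 = (ζ.re + a) ^ 2 + ζ.im ^ 2 := by
      rw [hq', show c - (a : ℂ) * e = c + ((-a : ℝ) : ℂ) * e by push_cast; ring, dist_frame c e he,
        show (ζ.re : ℂ) + ζ.im * Complex.I - ((-a : ℝ) : ℂ) =
          ((ζ.re + a : ℝ) : ℂ) + (ζ.im : ℂ) * Complex.I by push_cast; ring, Complex.sq_norm, Complex.normSq_add_mul_I]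
    have hDb' : dist q (c + a * e) ^ 2 = (ζ.re - a) ^ 2 + ζ.im ^ 2 := by
      rw [hq', dist_frame c e he, show (ζ.re : ℂ) + ζ.im * Complex.I - (a : ℂ) =
        ((ζ.re - a : ℝ) : ℂ) + (ζ.im : ℂ) * Complex.I by push_cast; ring, Complex.sq_norm, Complex.normSq_add_mul_I]
    have hFS : ∀ s ∈ S, 0 ≤ ζ.re ^ 2 + ζ.im ^ 2 - a ^ 2 - 2 * ζ.im * s := by
      intro s hs
      rw [← hF]
      have h1 := hcellS s hs q hq
      have h2 := pow_le_pow_left₀ dist_nonneg h1 2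
      linarith
    have hsep1 : r₂ ^ 2 ≤ (ζ.re - a) ^ 2 + ζ.im ^ 2 := by
      rw [← hDb']; exact pow_le_pow_left₀ hr₂.le hqr' 2
    have hsep2 : r₂ ^ 2 ≤ (ζ.re + a) ^ 2 + ζ.im ^ 2 := by
      rw [← hDb]; exact pow_le_pow_left₀ hr₂.le hqr 2
    have core : ∀ D : ℝ, 0 ≤ D → D ≤ 8 * ρ → D ^ 2 ≤ (|ζ.re| + a) ^ 2 + ζ.im ^ 2 →
        2 * μ * D ≤ ζ.re ^ 2 + ζ.im ^ 2 - a ^ 2 - 2 * ζ.im * ((sm + sp) / 2) :=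
      fun D hD0 hD8 hD2 => door_core' ha0 hr₂ hℓ₀ hμ h4 h64 hsm hsp hℓ (hFS sm hsmS) (hFS sp hspS)
        hsep1 hsep2 hD0 hD8 hD2
    rw [hF s₁]
    have habs1 : 0 ≤ |ζ.re| - ζ.re := by linarith [le_abs_self ζ.re]
    have habs2 : 0 ≤ |ζ.re| + ζ.re := by linarith [neg_le_abs ζ.re]
    constructor
    · refine core _ dist_nonneg (by linarith) ?_
      rw [hDb]
      nlinarith only [mul_nonneg habs1 (by linarith : 0 ≤ |ζ.re| + ζ.re + 2 * a)]
    · refine core _ dist_nonneg (by linarith) ?_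
      rw [hDb']
      nlinarith only [mul_nonneg habs2 (by linarith : 0 ≤ |ζ.re| - ζ.re + 2 * a)]

/-- **Registered sub-goal `stub_fatTube_part3`**: the door lemma (= `exists_door`). [folklore] -/
theorem stub_fatTube_part3 : ∀ {X V : Set ℂ} {ρ r₂ ℓ₀ μ : ℝ}, 0 < ρ → 0 < r₂ → 0 < ℓ₀ → 0 < μ → 4 * μ ≤ r₂ → 64 * μ * ρ ≤ ℓ₀ * r₂ → (∀ z ∈ V, ∃ p ∈ X, dist z p < ρ) → (∀ p ∈ X, ∀ q ∈ X, p ∈ V → dist p q < r₂ → p = q) → (∀ p ∈ X, ∀ q ∈ X, ∀ r ∈ X, ∀ r' ∈ X, ∀ v v' : ℂ, p ∈ V → p ≠ q → p ≠ r → q ≠ r → p ≠ r' → q ≠ r' → r ≠ r' → dist p v = dist q v → dist q v = dist r v → dist p v ≤ 2 * ρ → dist p v' = dist q v' → dist q v' = dist r' v' → dist p v' ≤ 2 * ρ → ℓ₀ ≤ dist v v') → ∀ {b b' z₀ : ℂ}, b ∈ X → b' ∈ X → b ≠ b' → z₀ ∈ voronoiCell X b → z₀ ∈ voronoiCell X b'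 → closedBall z₀ (7 * ρ) ⊆ V → ∃ m : ℂ, dist m b < ρ ∧ dist m b = dist m b' ∧ ∀ q ∈ X, q ≠ b → q ≠ b' → 2 * μ * dist q b ≤ dist m q ^ 2 - dist m b ^ 2 ∧ 2 * μ * dist q b' ≤ dist m q ^ 2 - dist m b' ^ 2 :=
  fun hρ hr₂ hℓ₀ hμ h4 h64 hcov hsep hedge _ _ _ hb hb' hbb' hz₀ hz₀' hV =>
    exists_door hρ hr₂ hℓ₀ hμ h4 h64 hcov hsep hedge hb hb' hbb' hz₀ hz₀' hV

end Summit.CriticalPhenomena.CardyFormulaZ2.Cruxes.SquareFromVoronoiHub.VoronoiBlocks.Faithful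

end
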